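import Mathlib

/-!
# Symmetric families I: a 2-transitive automorphism group forces the Marica–Schönheim pencil theorem (characteristic 0)

Helper file for crux `stmt-CriticalPhenomena-4575` (`NoHeavyLowerTail`, route `PercNearOneGluingNoHeavy`), new-inequality factory
seat `prim-ineq-gen-3` (gen 28).  Everything here is PROVED; no definitions.

Notation (memo `run/shared/lean/prim/prim-ineq-gen-3/THEOREM-SYMFIELD.md`): for a finite family `𝒜` with difference family
`D = 𝒜 \\ 𝒜` the PENCIL rows are `A ↦ (E ↦ [E ⊆ A] + t·[E ∩ A = ∅])`, and a DEPENDENCY at `t` is a coefficient vector `c` with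
`∑_A c_A ([E ⊆ A] + t [E ∩ A = ∅]) = 0` for every `E ∈ D`.  CONJECTURE (C0) says there is none for `t ∉ {0, ±1}` in characteristic 0.
The dependencies at `t` form a subspace `K_t` which is invariant under every permutation of the members that maps dependencies to
dependencies — in particular under the permutations induced by a permutation of the ground set mapping `𝒜` onto itself
(`pencil_dependency_comp_perm`).  This file proves the 2-transitive case of THEOREM S of the memo:

* `sub_single_mem_of_twoTransitive` — (linear algebra) over a field of characteristic 0, a non-zero subspace `V` of sum-zero vectors
  `ι → K` that is invariant under a finite group acting 2-TRANSITIVELY on `ι` contains every difference `e_i − e_j`.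
  [Average a vector `c ∈ V` with `c_{i₀} ≠ 0` over the stabiliser `H` of `i₀`: the average `w ∈ V` has `w_{i₀} = |H| c_{i₀} ≠ 0` and is
  constant off `i₀` (2-transitivity), and `∑ w = 0` forces the two values to differ; transporting `i₀` to `i₁` and subtracting gives
  `(w_{i₀} − w_{i₁}) (e_{i₀} − e_{i₁}) ∈ V`.]
* `pencil_dependency_comp_perm` — a permutation `π` of the members induced by a permutation `σ` of the ground set
  (`x ∈ π A ↔ σ⁻¹ x ∈ A`) maps dependencies to dependencies (any field, any `t`).
* `pencil_dependency_eq_zero_of_twoTransitive_of_invariant` — ★ if a finite group acts 2-transitively on the members of `𝒜` by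
  permutations preserving dependencies at `t`, and `t ≠ ±1`, then every dependency at `t` vanishes (characteristic 0).
  [`e_A − e_B ∈ K_t` says rows `A` and `B` of the pencil agree; at the column `A \ B` (or `B \ A`) they differ by `1 − t`.]
* `pencil_dependency_eq_zero_of_twoTransitive`, `linearIndependent_pencil_of_twoTransitive` — ★ the same for a group of
  permutations of the ground set mapping `𝒜` onto itself and acting 2-transitively on the members: (C0) holds for such families at every
  `t ≠ ±1` over every field of characteristic 0 (e.g. the lines of a Desarguesian projective or affine plane, the blocks of any
  2-transitive design, the `k`-subsets of an `n`-set).  In characteristic `p` this fails: the Fano plane is 2-transitive and has the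
  dependency `𝟙` over `𝔽₇` at `t = 3` (`…OrderedDifferencesFano`); there `|H| c_{i₀} + 6 b = 0` is solved by the constant vector.
(prim-ineq-gen-3 gen 28, 2026-08-25.)
-/

namespace Summit.CriticalPhenomena.PercolationContinuityZ3.Theorems

namespace OrderedDifferences

open Finset
open scoped FinsetFamily

variable {α : Type*} [DecidableEq α] {K : Type*} [Field K]

/-- **2-transitive invariant subspaces of sum-zero vectors.**  Let `K` be a field of characteristic 0, `ρ : G → Perm ι` a homomorphism
from a finite group whose image is 2-transitive on `ι`, and `V` a subspace of `ι → K` consisting of sum-zero vectors and invariant under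
`c ↦ c ∘ ρ g`.  If `V ≠ 0` then `e_i − e_j ∈ V` for all `i, j`. -/
theorem sub_single_mem_of_twoTransitive [CharZero K] {ι : Type*} [Fintype ι] [DecidableEq ι]
    {G : Type*} [Group G] [Fintype G] (ρ : G →* Equiv.Perm ι)
    (h2 : ∀ i j i' j' : ι, i ≠ j → i' ≠ j' → ∃ g : G, ρ g i = i' ∧ ρ g j = j')
    (V : Submodule K (ι → K)) (hV : ∀ g : G, ∀ c ∈ V, (c ∘ ⇑(ρ g)) ∈ V)
    (hsum : ∀ c ∈ V, ∑ i, c i = 0) {c : ι → K} (hcV : c ∈ V) (hc : c ≠ 0) (i j : ι) :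
    (Pi.single i (1 : K) - Pi.single j 1) ∈ V := by
  classical
  -- a coordinate where `c` is non-zero, and a second index
  obtain ⟨i0, hi0⟩ : ∃ i0, c i0 ≠ 0 := Function.ne_iff.mp hc
  have hex1 : ∃ i1, i1 ≠ i0 := by
    by_contra hno
    push Not at hno
    have hs : ∑ i, c i = c i0 := by
      rw [Finset.sum_eq_single i0 (fun b _ hb => absurd (hno b) hb) (fun h => absurd (mem_univ i0) h)]
    exact hi0 (hs ▸ hsum c hcV)
  obtain ⟨i1, hi1⟩ := hex1
  -- the stabiliser of `i0` and the averaged vector `w`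
  set H : Finset G := univ.filter (fun g => ρ g i0 = i0) with hH
  have hmemH : ∀ g, g ∈ H ↔ ρ g i0 = i0 := fun g => by simp [hH]
  have h1H : (1 : G) ∈ H := (hmemH 1).mpr (by simp)
  set w : ι → K := ∑ h ∈ H, (c ∘ ⇑(ρ h)) with hw
  have hw_apply : ∀ j, w j = ∑ h ∈ H, c (ρ h j) := by
    intro j
    simp only [hw, Finset.sum_apply, Function.comp_apply]
  have hwV : w ∈ V := V.sum_mem fun h _ => hV h c hcV
  -- `w i0 = |H| c i0 ≠ 0`
  have hwi0 : w i0 = (#H : K) * c i0 := by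
    rw [hw_apply, sum_congr rfl (fun h hh => by rw [(hmemH h).mp hh] : ∀ h ∈ H, c (ρ h i0) = c i0),
      sum_const, nsmul_eq_mul]
  have hHcard : (#H : K) ≠ 0 := by
    have : 0 < #H := card_pos.mpr ⟨1, h1H⟩
    exact_mod_cast this.ne'
  have ha : w i0 ≠ 0 := by
    rw [hwi0]
    exact mul_ne_zero hHcard hi0
  -- `w` is `H`-invariant
  have hwinv : ∀ g ∈ H, ∀ j, w (ρ g j) = w j := by
    intro g hg j
    rw [hw_apply, hw_apply]
    refine sum_equiv (Equiv.mulRight g) (fun h => ?_) (fun h _ => ?_)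
    · rw [hmemH, hmemH, Equiv.coe_mulRight, map_mul, Equiv.Perm.mul_apply, (hmemH g).mp hg]
    · rw [Equiv.coe_mulRight, map_mul, Equiv.Perm.mul_apply]
  -- hence constant off `i0`
  have hconst : ∀ j j', j ≠ i0 → j' ≠ i0 → w j' = w j := by
    intro j j' hj hj'
    obtain ⟨g, hg1, hg2⟩ := h2 i0 j i0 j' (Ne.symm hj) (Ne.symm hj')
    rw [← hg2]
    exact hwinv g ((hmemH g).mpr hg1) j
  -- the two values differ
  have hab : w i0 ≠ w i1 := by
    intro hab
    have hall : ∀ j, w j = w i0 := by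
      intro j
      by_cases hj : j = i0
      · rw [hj]
      · rw [hconst i1 j hi1 hj, ← hab]
    have hs : ∑ j, w j = (Fintype.card ι : K) * w i0 := by
      rw [sum_congr rfl (fun j _ => hall j), sum_const, nsmul_eq_mul, card_univ]
    have hcard : (Fintype.card ι : K) ≠ 0 := by
      have : 0 < Fintype.card ι := Fintype.card_pos_iff.mpr ⟨i0⟩
      exact_mod_cast this.ne'
    exact ha ((mul_eq_zero.mp (hs ▸ hsum w hwV : (Fintype.card ι : K) * w i0 = 0)).resolve_left hcard)
  -- key step: `e_{i0} - e_k ∈ V` for every `k ≠ i0`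
  have key : ∀ k, k ≠ i0 → (Pi.single i0 (1 : K) - Pi.single k 1) ∈ V := by
    intro k hk
    obtain ⟨g, hg1, hg2⟩ := h2 k i0 i0 k hk (Ne.symm hk)
    have hw'V : (w ∘ ⇑(ρ g)) ∈ V := hV g w hwV
    have hk0 : w k = w i1 := hconst i1 k hi1 hk
    have hdiff : w - (w ∘ ⇑(ρ g)) = (w i0 - w i1) • (Pi.single i0 (1 : K) - Pi.single k 1) := by
      funext j
      simp only [Pi.sub_apply, Function.comp_apply, Pi.smul_apply, smul_eq_mul, Pi.single_apply]
      by_cases hj0 : j = i0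
      · subst hj0
        rw [hg2, hk0, if_pos rfl, if_neg (Ne.symm hk)]
        ring
      · by_cases hjk : j = k
        · subst hjk
          rw [hg1, hk0, if_neg hj0, if_pos rfl]
          ring
        · have hgj : ρ g j ≠ i0 := by
            intro h
            exact hjk ((ρ g).injective (h.trans hg1.symm))
          rw [hconst i1 j hi1 hj0, hconst i1 (ρ g j) hi1 hgj, if_neg hj0, if_neg hjk]
          ring
    have hmem : (w i0 - w i1) • (Pi.single i0 (1 : K) - Pi.single k 1) ∈ V := by
      rw [← hdiff]
      exact V.sub_mem hwV hw'V
    exact (V.smul_mem_iff (sub_ne_zero.mpr hab)).mp hmem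
  -- conclusion
  by_cases hij : i = j
  · subst hij
    rw [sub_self]
    exact V.zero_mem
  by_cases hi : i = i0
  · subst hi
    exact key j (Ne.symm hij)
  by_cases hj : j = i0
  · subst hj
    have h := V.neg_mem (key i hi)
    rwa [neg_sub] at h
  have h := V.sub_mem (key j hj) (key i hi)
  rwa [sub_sub_sub_cancel_left] at h

/-- **Ground-set symmetries preserve dependencies.**  Let `π` be a permutation of the members of `𝒜` induced by a permutation `σ` of
the ground set (`x ∈ π A ↔ σ⁻¹ x ∈ A`).  If `c` is a dependency of the pencil rows over `𝒜 \\ 𝒜` at `t`, so is `c ∘ π`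
(any field, any `t`). -/
theorem pencil_dependency_comp_perm (𝒜 : Finset (Finset α)) (t : K) (π : Equiv.Perm ↥𝒜) (σ : Equiv.Perm α)
    (hπ : ∀ A : ↥𝒜, ∀ x, x ∈ ((π A : ↥𝒜) : Finset α) ↔ σ.symm x ∈ (A : Finset α))
    (c : ↥𝒜 → K)
    (hdep : ∀ E ∈ 𝒜 \\ 𝒜, ∑ A : 𝒜, c A * ((if E ⊆ (A : Finset α) then (1 : K) else 0) +
        t * (if Disjoint E (A : Finset α) then (1 : K) else 0)) = 0) :
    ∀ E ∈ 𝒜 \\ 𝒜, ∑ A : 𝒜, (c ∘ ⇑π) A * ((if E ⊆ (A : Finset α) then (1 : K) else 0) +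
        t * (if Disjoint E (A : Finset α) then (1 : K) else 0)) = 0 := by
  classical
  intro E hE
  -- the transported column
  set E' : Finset α := E.map σ.toEmbedding with hE'def
  have hmemE' : ∀ x, x ∈ E' ↔ σ.symm x ∈ E := fun x => by rw [hE'def, mem_map_equiv]
  have hE' : E' ∈ 𝒜 \\ 𝒜 := by
    obtain ⟨A1, hA1, A2, hA2, rfl⟩ := mem_diffs.mp hE
    refine mem_diffs.mpr ⟨(π ⟨A1, hA1⟩ : ↥𝒜), (π ⟨A1, hA1⟩).2, (π ⟨A2, hA2⟩ : ↥𝒜), (π ⟨A2, hA2⟩).2, ?_⟩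
    ext x
    rw [hmemE', mem_sdiff, mem_sdiff, hπ, hπ]
  -- containers and avoiders are transported
  have hsub : ∀ B : ↥𝒜, E' ⊆ ((π B : ↥𝒜) : Finset α) ↔ E ⊆ (B : Finset α) := by
    intro B
    constructor
    · intro h x hx
      have h1 : σ x ∈ E' := (hmemE' (σ x)).mpr (by simpa using hx)
      have h2 := h h1
      rw [hπ] at h2
      simpa using h2
    · intro h x hx
      rw [hπ]
      exact h ((hmemE' x).mp hx)
  have hdis : ∀ B : ↥𝒜, Disjoint E' ((π B : ↥𝒜) : Finset α) ↔ Disjoint E (B : Finset α) := by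
    intro B
    rw [disjoint_left, disjoint_left]
    constructor
    · intro h x hx hxB
      have h1 : σ x ∈ E' := (hmemE' (σ x)).mpr (by simpa using hx)
      have h2 : σ x ∈ ((π B : ↥𝒜) : Finset α) := (hπ B (σ x)).mpr (by simpa using hxB)
      exact h h1 h2
    · intro h x hx hxB
      exact h ((hmemE' x).mp hx) ((hπ B x).mp hxB)
  -- reindex the dependency equation at the column `E'`
  have h := hdep E' hE'
  rw [← Equiv.sum_comp π] at h
  calc ∑ A : 𝒜, (c ∘ ⇑π) A * ((if E ⊆ (A : Finset α) then (1 : K) else 0) +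
          t * (if Disjoint E (A : Finset α) then (1 : K) else 0))
        = ∑ B : 𝒜, c (π B) * ((if E' ⊆ ((π B : ↥𝒜) : Finset α) then (1 : K) else 0) +
          t * (if Disjoint E' ((π B : ↥𝒜) : Finset α) then (1 : K) else 0)) := by
          refine sum_congr rfl fun B _ => ?_
          simp only [Function.comp_apply, hsub B, hdis B]
    _ = 0 := h

/-- **THEOREM S, 2-transitive case (abstract symmetry).**  Let `K` have characteristic 0 and `t ≠ ±1`.  Suppose a finite group `G`
acts on the members of `𝒜` through `ρ : G →* Perm 𝒜`, 2-transitively, and every `ρ g` maps dependencies of the pencil at `t` to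
dependencies (`c ↦ c ∘ ρ g`).  Then every dependency at `t` is zero. -/
theorem pencil_dependency_eq_zero_of_twoTransitive_of_invariant [CharZero K] (𝒜 : Finset (Finset α)) {t : K}
    (ht1 : t ≠ 1) (ht2 : t ≠ -1)
    {G : Type*} [Group G] [Fintype G] (ρ : G →* Equiv.Perm ↥𝒜)
    (hinv : ∀ g : G, ∀ d : ↥𝒜 → K,
      (∀ E ∈ 𝒜 \\ 𝒜, ∑ A : 𝒜, d A * ((if E ⊆ (A : Finset α) then (1 : K) else 0) +
        t * (if Disjoint E (A : Finset α) then (1 : K) else 0)) = 0) →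
      (∀ E ∈ 𝒜 \\ 𝒜, ∑ A : 𝒜, (d ∘ ⇑(ρ g)) A * ((if E ⊆ (A : Finset α) then (1 : K) else 0) +
        t * (if Disjoint E (A : Finset α) then (1 : K) else 0)) = 0))
    (h2 : ∀ A B A' B' : ↥𝒜, A ≠ B → A' ≠ B' → ∃ g : G, ρ g A = A' ∧ ρ g B = B')
    (c : ↥𝒜 → K)
    (hdep : ∀ E ∈ 𝒜 \\ 𝒜, ∑ A : 𝒜, c A * ((if E ⊆ (A : Finset α) then (1 : K) else 0) +
        t * (if Disjoint E (A : Finset α) then (1 : K) else 0)) = 0) : c = 0 := by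
  classical
  by_contra hc
  -- the space of dependencies at `t`
  let V : Submodule K (↥𝒜 → K) :=
    { carrier := {d | ∀ E ∈ 𝒜 \\ 𝒜, ∑ A : 𝒜, d A * ((if E ⊆ (A : Finset α) then (1 : K) else 0) +
        t * (if Disjoint E (A : Finset α) then (1 : K) else 0)) = 0}
      add_mem' := by
        intro d e hd he E hE
        have h1 := hd E hE
        have h2 := he E hE
        simp only [Pi.add_apply, add_mul, sum_add_distrib, h1, h2, add_zero]
      zero_mem' := by
        intro E hE
        simp
      smul_mem' := by
        intro r d hd E hE
        have h1 := hd E hE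
        simp only [Pi.smul_apply, smul_eq_mul, mul_assoc, ← mul_sum, h1, mul_zero] }
  have hmemV : ∀ d : ↥𝒜 → K, d ∈ V ↔ ∀ E ∈ 𝒜 \\ 𝒜, ∑ A : 𝒜, d A * ((if E ⊆ (A : Finset α) then (1 : K) else 0) +
        t * (if Disjoint E (A : Finset α) then (1 : K) else 0)) = 0 := fun d => Iff.rfl
  have hcV : c ∈ V := (hmemV c).mpr hdep
  have hV : ∀ g : G, ∀ d ∈ V, (d ∘ ⇑(ρ g)) ∈ V := fun g d hd => (hmemV _).mpr (hinv g d ((hmemV d).mp hd))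
  -- a member where `c ≠ 0`; the `∅` column gives `∑ d = 0` on `V`
  obtain ⟨A0, hA0⟩ : ∃ A0, c A0 ≠ 0 := Function.ne_iff.mp hc
  have hD : ∀ A ∈ 𝒜, ∀ B ∈ 𝒜, A \ B ∈ 𝒜 \\ 𝒜 := fun A hA B hB => mem_diffs.mpr ⟨A, hA, B, hB, rfl⟩
  have hempty : (∅ : Finset α) ∈ 𝒜 \\ 𝒜 := by simpa using hD A0 A0.2 A0 A0.2
  have hsum : ∀ d ∈ V, ∑ A, d A = 0 := by
    intro d hd
    have h := (hmemV d).mp hd ∅ hempty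
    have e : ∑ A : 𝒜, d A * ((if (∅ : Finset α) ⊆ (A : Finset α) then (1 : K) else 0) +
        t * (if Disjoint (∅ : Finset α) (A : Finset α) then (1 : K) else 0)) = (1 + t) * ∑ A : 𝒜, d A := by
      rw [mul_sum]
      refine sum_congr rfl fun A _ => ?_
      simp only [empty_subset, if_true, disjoint_empty_left]
      ring
    rw [e] at h
    have h1t : (1 + t) ≠ 0 := fun h1 => ht2 (by linear_combination h1)
    exact (mul_eq_zero.mp h).resolve_left h1t
  -- a second member
  have hex1 : ∃ B0 : ↥𝒜, B0 ≠ A0 := by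
    by_contra hno
    push Not at hno
    have hs : ∑ A, c A = c A0 := by
      rw [Finset.sum_eq_single A0 (fun b _ hb => absurd (hno b) hb) (fun h => absurd (mem_univ A0) h)]
    exact hA0 (hs ▸ hsum c hcV)
  obtain ⟨B0, hB0⟩ := hex1
  -- `e_{A0} - e_{B0}` is a dependency
  have hkey := sub_single_mem_of_twoTransitive ρ h2 V hV hsum hcV hc A0 B0
  rw [hmemV] at hkey
  -- evaluate it at the column `A0 \ B0` or `B0 \ A0`
  have heval : ∀ E ∈ 𝒜 \\ 𝒜,
      ((if E ⊆ (A0 : Finset α) then (1 : K) else 0) + t * (if Disjoint E (A0 : Finset α) then (1 : K) else 0)) -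
      ((if E ⊆ (B0 : Finset α) then (1 : K) else 0) + t * (if Disjoint E (B0 : Finset α) then (1 : K) else 0)) = 0 := by
    intro E hE
    have h := hkey E hE
    simp only [Pi.sub_apply, Pi.single_apply, sub_mul, sum_sub_distrib, ite_mul, one_mul, zero_mul,
      sum_ite_eq', mem_univ, if_true] at h
    exact h
  by_cases hAB : (A0 : Finset α) ⊆ (B0 : Finset α)
  · -- use the column `B0 \ A0`
    have hne : ¬ (B0 : Finset α) ⊆ (A0 : Finset α) := by
      intro h
      exact hB0 (Subtype.ext (subset_antisymm h hAB))
    obtain ⟨x, hx⟩ : ((B0 : Finset α) \ (A0 : Finset α)).Nonempty :=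
      nonempty_iff_ne_empty.mpr (fun h0 => hne (sdiff_eq_empty_iff_subset.mp h0))
    have h := heval _ (hD _ B0.2 _ A0.2)
    have c1 : ¬ ((B0 : Finset α) \ (A0 : Finset α) ⊆ (A0 : Finset α)) := fun hs => (mem_sdiff.mp hx).2 (hs hx)
    have c2 : Disjoint ((B0 : Finset α) \ (A0 : Finset α)) (A0 : Finset α) := sdiff_disjoint
    have c3 : (B0 : Finset α) \ (A0 : Finset α) ⊆ (B0 : Finset α) := sdiff_subset
    have c4 : ¬ Disjoint ((B0 : Finset α) \ (A0 : Finset α)) (B0 : Finset α) :=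
      fun hd => (disjoint_left.mp hd) hx (mem_sdiff.mp hx).1
    rw [if_neg c1, if_pos c2, if_pos c3, if_neg c4] at h
    exact ht1 (by linear_combination h)
  · -- use the column `A0 \ B0`
    obtain ⟨x, hx⟩ : ((A0 : Finset α) \ (B0 : Finset α)).Nonempty :=
      nonempty_iff_ne_empty.mpr (fun h0 => hAB (sdiff_eq_empty_iff_subset.mp h0))
    have h := heval _ (hD _ A0.2 _ B0.2)
    have c1 : (A0 : Finset α) \ (B0 : Finset α) ⊆ (A0 : Finset α) := sdiff_subset
    have c2 : ¬ Disjoint ((A0 : Finset α) \ (B0 : Finset α)) (A0 : Finset α) :=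
      fun hd => (disjoint_left.mp hd) hx (mem_sdiff.mp hx).1
    have c3 : ¬ ((A0 : Finset α) \ (B0 : Finset α) ⊆ (B0 : Finset α)) := fun hs => (mem_sdiff.mp hx).2 (hs hx)
    have c4 : Disjoint ((A0 : Finset α) \ (B0 : Finset α)) (B0 : Finset α) := sdiff_disjoint
    rw [if_pos c1, if_neg c2, if_neg c3, if_pos c4] at h
    exact ht1 (by linear_combination -h)

/-- **THEOREM S, 2-transitive case (ground-set symmetries).**  Let `K` have characteristic 0 and `t ≠ ±1`.  Suppose a finite
group `G` acts on the members of `𝒜` through `ρ : G →* Perm 𝒜`, every `ρ g` being induced by a permutation of the ground set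
(`x ∈ ρ g A ↔ σ⁻¹ x ∈ A`), and 2-transitively.  Then the pencil rows of `𝒜` over `𝒜 \\ 𝒜` have no dependency at `t`. -/
theorem pencil_dependency_eq_zero_of_twoTransitive [CharZero K] (𝒜 : Finset (Finset α)) {t : K}
    (ht1 : t ≠ 1) (ht2 : t ≠ -1)
    {G : Type*} [Group G] [Fintype G] (ρ : G →* Equiv.Perm ↥𝒜)
    (hρ : ∀ g : G, ∃ σ : Equiv.Perm α, ∀ A : ↥𝒜, ∀ x, x ∈ ((ρ g A : ↥𝒜) : Finset α) ↔ σ.symm x ∈ (A : Finset α))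
    (h2 : ∀ A B A' B' : ↥𝒜, A ≠ B → A' ≠ B' → ∃ g : G, ρ g A = A' ∧ ρ g B = B')
    (c : ↥𝒜 → K)
    (hdep : ∀ E ∈ 𝒜 \\ 𝒜, ∑ A : 𝒜, c A * ((if E ⊆ (A : Finset α) then (1 : K) else 0) +
        t * (if Disjoint E (A : Finset α) then (1 : K) else 0)) = 0) : c = 0 := by
  refine pencil_dependency_eq_zero_of_twoTransitive_of_invariant 𝒜 ht1 ht2 ρ (fun g d hd => ?_) h2 c hdep
  obtain ⟨σ, hσ⟩ := hρ g
  exact pencil_dependency_comp_perm 𝒜 t (ρ g) σ hσ d hd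

/-- **(C0) for 2-transitively symmetric families (characteristic 0).**  Under the hypotheses of
`pencil_dependency_eq_zero_of_twoTransitive` the pencil rows `A ↦ (E ↦ [E ⊆ A] + t [E ∩ A = ∅])` over `𝒜 \\ 𝒜` are linearly
independent for every `t ≠ ±1`. -/
theorem linearIndependent_pencil_of_twoTransitive [CharZero K] (𝒜 : Finset (Finset α)) {t : K}
    (ht1 : t ≠ 1) (ht2 : t ≠ -1)
    {G : Type*} [Group G] [Fintype G] (ρ : G →* Equiv.Perm ↥𝒜)
    (hρ : ∀ g : G, ∃ σ : Equiv.Perm α, ∀ A : ↥𝒜, ∀ x, x ∈ ((ρ g A : ↥𝒜) : Finset α) ↔ σ.symm x ∈ (A : Finset α))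
    (h2 : ∀ A B A' B' : ↥𝒜, A ≠ B → A' ≠ B' → ∃ g : G, ρ g A = A' ∧ ρ g B = B') :
    LinearIndependent K (fun A : 𝒜 => fun E : (𝒜 \\ 𝒜 : Finset (Finset α)) =>
      (if (E : Finset α) ⊆ (A : Finset α) then (1 : K) else 0) +
        t * (if Disjoint (E : Finset α) (A : Finset α) then (1 : K) else 0)) := by
  classical
  rw [Fintype.linearIndependent_iff]
  intro c hc
  have h0 := pencil_dependency_eq_zero_of_twoTransitive 𝒜 ht1 ht2 ρ hρ h2 c (fun E hE => by
    have h := congr_fun hc ⟨E, hE⟩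
    simpa only [Finset.sum_apply, Pi.smul_apply, smul_eq_mul, Pi.zero_apply] using h)
  intro A
  rw [h0, Pi.zero_apply]

end OrderedDifferences

end Summit.CriticalPhenomena.PercolationContinuityZ3.Theorems
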